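import Summits.QuantumFields.YangMills.Theorems.BalabanUVNodesN06Delta2AtPinsPhysP
import Literature.MathematicalPhysics.QuantumFieldTheory.Balaban1983to89.B9SupLettersFromClassLetters
import Literature.MathematicalPhysics.QuantumFieldTheory.Balaban1983to89.B9PinGeometryKLevelV1B
import Literature.MathematicalPhysics.QuantumFieldTheory.Balaban1983to89.B9LettersHZAtOne

/-!
# N06 [B9] — THE CERTIFICATE's (3.137) BINDER `hD2sup` AS A THEOREM AT def-Y's `G′_phys`-FED RESIDUAL (programme P-D2, leg F-D: the composition)

T. Bałaban, *Propagators for lattice gauge theories in a background field*, Commun. Math. Phys. **99** (1985) 389–434 [`Balaban1985BackgroundPropagators`, "B9"],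
Thm 3.12 pp. 421–423: (3.130), (3.132)–(3.133) p. 422, (3.134)–(3.137) pp. 422–423 (*«hence |(Δ⁽²⁾A)(b)| ≦ O(1)Mα₀(Lʲη)⁻²|A|, b ∈ Δ(y), y ∈ Λ_j (3.137)»*), (3.36) p. 396,
p. 398, p. 421 (*«C⁽²⁾(A) equals to LʲηC_j⁽²⁾(A) on Λ_j»*); [5] = T. Bałaban, *Averaging operations for lattice gauge theories*, Commun. Math. Phys. **98** (1985) 17–51
[`Balaban1985Averaging`], (149) p. 40; [4] = T. Bałaban, *Propagators and renormalization transformations for lattice gauge theories. II*, Commun. Math. Phys. **96**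
(1984) 223–250 [`Balaban1984PropagatorsII`], (2.51)–(2.56) pp. 232–233, Lemma 2.1 (2.60)–(2.61) p. 234.

WHY (cell `pub-ymgap`, node N06, bundle F7 rows 20–21, seat dag-n06-l g33; LOCATED-D2).  The certificate of record `…N06AtOpsYNuOfRecordV6EPairVH` DISPLAYS print's
(3.137) as the binder `hD2sup` (and the symmetry `hΔ2`) about a FREE residual datum `(𝔯 x).Δ2`.  With def-Y's `Node00.OpsYDelta2FormP.resYOfC2P` (p763134:
`(resYOfC2P … 𝔠 x).Δ2 = delta2OfY (trDualMatY N) x.toKIdx (parSymY …) (parBY …) (GpPhysY … (parSymY …)) (𝔠 x).form`, rfl) the residual becomes (3.134)'s function of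
[5]'s form letter `𝔠`, and THIS FILE makes `hD2sup` a THEOREM of the certificate's OWN earlier layers:
★★★ `d2sup_of_pins` — inputs (all in the certificate's currencies at its class-parametric carrier `bg9YR … R₁ R₂ x`): the SCALED sup letter of `G_D` BEFORE the leaf
(`hGD`, this seat's `…N06GDSupSqLegAtPinsPUW.gdsup_sq_of_pins` = PASS 1 of the U8 state layer at the flat residual + `entry0_of_stepS_resolvent`), the (3.132) CLASS letter of
`C = (QGQ*)⁻¹` (`hc2`, the certificate's `zletters_of_pins` conjunct from row 26), the pins `hblk12 hblkZ12 hGco12 hCco12 hbI0 hβ1`, the class bridge `hRP2` (⇒ print's cube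
class, where r06's bond-local regularity `RegularAt` at every fine bond is n06-w8's THEOREM `regularAt_pinScale_of_regYP336`), `hGR : MemOfFam SU(N) R₁`, and ONE displayed
letter `hC2` = [5] (149) for `𝔠` in the three-point block form `B9Delta2FormMajorant.C2FormMaj` AT PRINT'S WEIGHT `wC(c) = (Lʲη)_c·n_c⁻¹` (p. 421 «C⁽²⁾ = LʲηC_j⁽²⁾ on Λ_j» ×
(149)'s block average `Q″_j|δ_z⊗a| = ‖a‖∕n_c`, `n_c = ((ℓ+1)^{d+1})^{lvl c}` the fine-site count of the coarse cell; lit-balaban-r06 page check 2026-08-30) — plus numerics;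
output: the VH-shape `hD2sup` at `Δ2 := delta2OfY … GpPhysY … (𝔠 x).form` with `θ₂` ∃-PRODUCED (closed form) and a produced regime letter `aD ≤ aG` (`10(ℓ+1)⁷·aD ≤ 1`,
print's «α₀ so small that O(1)Mα₀ is still sufficiently small»).  Chain inside: `hc2` ⟶ (n06-w8 F11 `hasMajorantHom_of_hasMaj_cNorm_weightNorm`) the weighted flat letter of
`C` (`W_C = n·(Lʲη)⁻²`, rate `δC − τT`) ⟶ with `hGD` through `…N06Delta2AtPinsPhysP.hD2sup_of_GD_C_lettersRP_sq` (scaled transpose road: `W_T = W_C·(Lʲη)² = n`, `H† = n·H*`,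
`w_H = n·(Lʲη)⁻³` = print's `O(1)Mα₀(Lʲη)⁻³` for `H*`; `hreg` discharged through `hRP2`).
FOLD RECIPE (dag-n06-d, edition after VJ; with def-Y's recipe I.32342): `𝔯 := resYOfC2P N θ.toStage3Params Mstar 𝔠`; obtain `⟨MG, aG, rG, …, hGD⟩ := gdsup_sq_of_pins …` (the
state layer's argument list minus `Δ2 hT2co12 θ₂ δ₂ hθ₂ hr2 hD2`, plus `ha₀ hI ρG`), then `⟨MD, aD, θ₂, haD0, haDG, hθ₂0, hMD, hD2sup⟩ := d2sup_of_pins …`; −`hD2sup` −`hΔ2`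
(`:= resYOfC2P_Δ2_isSymmTr_SU …`) −`θ₂ hθ₂`; `δ₂` stays displayed with `hrT2 : rT ≤ δ₂` and the NEW budget lines of this theorem; + `hC2` + `h𝔠real`.
HONEST LABEL: helper (composition of landed faces by name), count-neutral; [5] (149) (`hC2`), the layers' letters and the numerics are HYPOTHESES; N06 NOT discharged;
K1 NOT closed; nothing continuum ∕ OS ∕ mass gap ∕ Clay.  NEW file; nothing landed is modified.
-/

noncomputable section

namespace Summit.QuantumFields.YangMills.BalabanUVNodes.N06D2SupLegAtPinsPUW

open Literature.MathematicalPhysics.QuantumFieldTheory.Balaban1983to89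
open Literature.MathematicalPhysics.QuantumFieldTheory.Balaban1983to89.Node00 (CfgY FBondY IBondY GpY GpPhysY parSymY parBY trDualMatY trAdjY JY Stage3Params C2Y
  delta2OfY etaBY)
open Literature.MathematicalPhysics.QuantumFieldTheory.Balaban1983to89.Node00.OpsYSectDCoords (QcoKH CcoK cR39_trBasis_pos)
open Literature.MathematicalPhysics.QuantumFieldTheory.Balaban1983to89.B9Eq3132SectDLetters (GDY HDY)
open Literature.MathematicalPhysics.QuantumFieldTheory.Balaban1983to89.B9Thm34Ext (toB6)
open Literature.MathematicalPhysics.QuantumFieldTheory.Balaban1983to89.B6RandomWalk (HasMajorant hasMajorant_mono)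
open Literature.MathematicalPhysics.QuantumFieldTheory.Balaban1983to89.B6RandomWalkHom (HasMajorantHom hasMajorantHom_mono hasMajorantHom_iff)
open Literature.MathematicalPhysics.QuantumFieldTheory.Balaban1983to89.B11SectG (HasMaj BlockNorm RowSum)
open Literature.MathematicalPhysics.QuantumFieldTheory.Balaban1983to89.B9Thm312Whole (GeoOK cNorm)
open Literature.MathematicalPhysics.QuantumFieldTheory.Balaban1983to89.B9SectDSup (weightNorm)
open Literature.MathematicalPhysics.QuantumFieldTheory.Balaban1983to89.B9RWSums343to347Whole (Facts347)
open Literature.MathematicalPhysics.QuantumFieldTheory.Balaban1983to89.B9RWSumsDefinitePins (PinPrims)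
open Literature.MathematicalPhysics.QuantumFieldTheory.Balaban1983to89.B9RWSums347DefiniteFaces (facts347_exp261_geo9Y)
open Literature.MathematicalPhysics.QuantumFieldTheory.Balaban1983to89.B9RowSum261DefiniteFaces (rowConst261 rowConst261_nonneg)
open Literature.MathematicalPhysics.QuantumFieldTheory.Balaban1983to89.B9PinMembersKLevelV1 (MemberY geo9Y)
open Literature.MathematicalPhysics.QuantumFieldTheory.Balaban1983to89.B9PinGeometryKLevelV1 (c35Y)
open Literature.MathematicalPhysics.QuantumFieldTheory.Balaban1983to89.B9PinGeometryKLevelV1B (c35Y_le_ten)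
open Literature.MathematicalPhysics.QuantumFieldTheory.Balaban1983to89.B9BackgroundsKLevelV1R (RegFamY bg9YR MemOfFam)
open Literature.MathematicalPhysics.QuantumFieldTheory.Balaban1983to89.B9BackgroundsKLevelV1P (bg9YP)
open Literature.MathematicalPhysics.QuantumFieldTheory.Balaban1983to89.B9GeoLemma21KLevelV1 (geo9Y_len_pos geo9Y_dist_triangle geo9Y_dist_comm)
open Literature.MathematicalPhysics.QuantumFieldTheory.Balaban1983to89.B9GeoNormsKLevelV1 (geo9K geo9K_dist_nonneg)
open Literature.MathematicalPhysics.QuantumFieldTheory.Balaban1983to89.B7Prop2SpecialUnitary (specialUnitaryUnits)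
open Literature.MathematicalPhysics.QuantumFieldTheory.Balaban1983to89.B9CoReadingCoords (XBK blkBK GcoK)
open Literature.MathematicalPhysics.QuantumFieldTheory.Balaban1983to89.B9CoReadingCoordsH (XHK blkHK)
open Literature.MathematicalPhysics.QuantumFieldTheory.Balaban1983to89.B9CoReadingCoordsS (XSK)
open Literature.MathematicalPhysics.QuantumFieldTheory.Balaban1983to89.B9CoReadingCoordsTranspose (TrIdx trBasis)
open Literature.MathematicalPhysics.QuantumFieldTheory.Balaban1983to89.B9Thm39ReadingCoords (cR39 basisBound39)
open Literature.MathematicalPhysics.QuantumFieldTheory.Balaban1983to89.B9PerturbationL2Delta2 (D2coK)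
open Literature.MathematicalPhysics.QuantumFieldTheory.Balaban1983to89.B9Delta2FormMajorant (C2FormMaj)
open Literature.MathematicalPhysics.QuantumFieldTheory.Balaban1983to89.B9SupLettersFromClassLetters (hasMajorantHom_of_hasMaj_cNorm_weightNorm)
open Literature.MathematicalPhysics.QuantumFieldTheory.Balaban1983to89.B9Eq336RegularAtAllBondsP (regularAt_pinScale_of_regYP336)
open Literature.MathematicalPhysics.QuantumFieldTheory.Balaban1983to89.B9LettersHZAtOne (plateau_pos)
open B6Ineq2142KLevelV1 (β lvl)
open B6GlobalChartV1 (blkV1)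
open B6Geom246MultiLevelTorus (geomT)
open Summit.QuantumFields.YangMills.BalabanUVNodes.N06Delta2AtPinsPhysP (hD2sup_of_GD_C_lettersRP_sq)
open scoped Matrix.Norms.L2Operator

variable {N : ℕ} [NeZero N] {θ : Stage3Params} {Mstar : ℕ}
variable [∀ x : MemberY θ.d₆ θ.ℓ₆ θ.hd' θ.hL' θ.b₀ θ.b₁ Mstar, Fintype (geo9Y x).Site]

/-- the product weight of the road is print's: `(Lʲη)·n⁻¹ · ((n·(Lʲη)⁻²·(Lʲη)²)·(Lʲη)⁻³) = (Lʲη)⁻²`. [cite: Balaban1985BackgroundPropagators, (3.136)–(3.137) pp.422–423, bookkeeping] -/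
private theorem weights_mul_eq {l p : ℝ} (hl : 0 < l) (hp : 0 < p) :
    l * p⁻¹ * ((p⁻¹⁻¹ * (l ^ 2)⁻¹ * l ^ 2) * (l ^ 3)⁻¹) = (l ^ 2)⁻¹ := by
  field_simp

/-- ★★★ **THE CERTIFICATE's `hD2sup` ((3.137)) AS A THEOREM at `Δ2 := delta2OfY … GpPhysY … (𝔠 x).form`** (module docstring): from the scaled sup letter of `G_D`
before the leaf (`hGD`), the (3.132) class letter of `C` (`hc2`), the pins, the class bridge `hRP2`, [5] (149) at print's weight (`hC2`) and numerics — above a threshold `MD`,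
in the produced regime `Mα₀ ≤ aD` (`0 < aD ≤ aG`), with the produced constant `θ₂ ≥ 0`:
`HasMajorant (𝔬12 x).blk (D2coK … ((delta2OfY … GpPhysY … (𝔠 x).form)) U) (θ₂·(M_xα₀)·(Lʲη)_a⁻²·e^{−δ₂ d})`.
[cite: Balaban1985BackgroundPropagators, (3.134)–(3.137) pp.422–423, (3.126) p.420, (3.130) p.421, (3.132)–(3.133) p.422, (3.36) p.396, p.398, p.421; Balaban1985Averaging, (149) p.40; Balaban1984PropagatorsII, (2.51) p.232, (2.54)–(2.56) p.233, Lemma 2.1 (2.60)–(2.61) p.234] -/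
theorem d2sup_of_pins (H : MemberY θ.d₆ θ.ℓ₆ θ.hd' θ.hL' θ.b₀ θ.b₁ Mstar → Prop) (𝔠 : C2Y N θ Mstar)
    {R₁ R₂ : RegFamY θ.d₆ θ.ℓ₆ θ.hd' θ.hL' θ.b₀ θ.b₁ Mstar (Matrix (Fin N) (Fin N) ℂ)} (hGR : MemOfFam (specialUnitaryUnits (Fin N)) R₁) (c : ℝ)
    (hRP2 : ∀ (x : MemberY θ.d₆ θ.ℓ₆ θ.hd' θ.hL' θ.b₀ θ.b₁ Mstar) (α₀ : ℝ) (U : (bg9YR (Matrix (Fin N) (Fin N) ℂ) (specialUnitaryUnits (Fin N)) R₁ R₂ x).Cfg),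
      (bg9YR (Matrix (Fin N) (Fin N) ℂ) (specialUnitaryUnits (Fin N)) R₁ R₂ x).Reg336 c α₀ U →
        0 ≤ α₀ ∧ (bg9YP (Matrix (Fin N) (Fin N) ℂ) (specialUnitaryUnits (Fin N)) x).Reg336 c35Y α₀ U)
    (𝔬12 : ∀ x : MemberY θ.d₆ θ.ℓ₆ θ.hd' θ.hL' θ.b₀ θ.b₁ Mstar, B9Thm312Whole.Ops (geo9Y x) (bg9YR (Matrix (Fin N) (Fin N) ℂ) (specialUnitaryUnits (Fin N)) R₁ R₂ x)
      (XBK (TrIdx N) x.toKIdx) (XBK (TrIdx N) x.toKIdx) (XHK (TrIdx N) x.toKIdx) (XSK (TrIdx N) x.toKIdx))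
    (bI : ∀ x : MemberY θ.d₆ θ.ℓ₆ θ.hd' θ.hL' θ.b₀ θ.b₁ Mstar, FBondY x.toKIdx → IBondY x.toKIdx)
    (hbI0 : ∀ (x : MemberY θ.d₆ θ.ℓ₆ θ.hd' θ.hL' θ.b₀ θ.b₁ Mstar) (f : FBondY x.toKIdx), bI x f = bI x ⟨f.src, 0⟩)
    (hβ1 : ∀ (x : MemberY θ.d₆ θ.ℓ₆ θ.hd' θ.hL' θ.b₀ θ.b₁ Mstar) (f : FBondY x.toKIdx), (geomT x.D).dist (β x.hN x.D x.hk (bI x f)) (blkV1 x.hN x.D f) ≤ 1)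
    (hblk12 : ∀ x : MemberY θ.d₆ θ.ℓ₆ θ.hd' θ.hL' θ.b₀ θ.b₁ Mstar, (𝔬12 x).blk = blkBK x.toKIdx (bI x))
    (hblkZ12 : ∀ x : MemberY θ.d₆ θ.ℓ₆ θ.hd' θ.hL' θ.b₀ θ.b₁ Mstar, (𝔬12 x).blkZ = blkHK x.toKIdx)
    (hGco12 : ∀ (x : MemberY θ.d₆ θ.ℓ₆ θ.hd' θ.hL' θ.b₀ θ.b₁ Mstar) (U : (bg9YR (Matrix (Fin N) (Fin N) ℂ) (specialUnitaryUnits (Fin N)) R₁ R₂ x).Cfg),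
      (𝔬12 x).G U = GcoK x.toKIdx (trBasis N) (bg9YR (Matrix (Fin N) (Fin N) ℂ) (specialUnitaryUnits (Fin N)) R₁ R₂ x) (fun U => U)
        (GDY x.toKIdx (parSymY x.toKIdx) (parBY x.toKIdx) (GpPhysY x.toKIdx (parSymY x.toKIdx))) U)
    (hCco12 : ∀ (x : MemberY θ.d₆ θ.ℓ₆ θ.hd' θ.hL' θ.b₀ θ.b₁ Mstar) (U : (bg9YR (Matrix (Fin N) (Fin N) ℂ) (specialUnitaryUnits (Fin N)) R₁ R₂ x).Cfg),
      (𝔬12 x).C U = CcoK x.toKIdx (trBasis N) (bg9YR (Matrix (Fin N) (Fin N) ℂ) (specialUnitaryUnits (Fin N)) R₁ R₂ x) (fun U => U)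
        (parSymY x.toKIdx) (parBY x.toKIdx) (GpPhysY x.toKIdx (parSymY x.toKIdx)) U)
    -- numerics: the regime of the inputs, their constants and rates, and the budget of the road
    {MG aG rG ρG Bz δC δ₂ κC δC2 : ℝ} (haG : 0 < aG) (hrG : 0 ≤ rG) (hρG : 0 < ρG) (hBz : 0 ≤ Bz) (hδC : 0 < δC) (hδ₂ : 0 ≤ δ₂) (hκC : 0 ≤ κC)
    (hgap : δ₂ < δC2)
    -- the SCALED sup letter of G_D before the leaf (`gdsup_sq_of_pins`)
    (hGD : ∀ x : MemberY θ.d₆ θ.ℓ₆ θ.hd' θ.hL' θ.b₀ θ.b₁ Mstar, MG ≤ (geo9Y x).M → ∀ α₀ : ℝ, 0 < α₀ → (geo9Y x).M * α₀ ≤ aG →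
      ∀ U : (bg9YR (Matrix (Fin N) (Fin N) ℂ) (specialUnitaryUnits (Fin N)) R₁ R₂ x).Cfg,
        (bg9YR (Matrix (Fin N) (Fin N) ℂ) (specialUnitaryUnits (Fin N)) R₁ R₂ x).Reg335 c α₀ U →
        (bg9YR (Matrix (Fin N) (Fin N) ℂ) (specialUnitaryUnits (Fin N)) R₁ R₂ x).Reg336 c α₀ U →
          HasMajorant (g := toB6 (geo9Y x) 1 (H x)) (𝔬12 x).blk ((𝔬12 x).G U) (fun a b => rG * (geo9Y x).len a ^ 2 * Real.exp (-(ρG * (geo9Y x).dist a b))))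
    -- the (3.132) class letter of C (`zletters_of_pins`, conjunct 4)
    (hc2 : ∀ x : MemberY θ.d₆ θ.ℓ₆ θ.hd' θ.hL' θ.b₀ θ.b₁ Mstar, MG ≤ (geo9Y x).M → ∀ α₀ : ℝ, 0 < α₀ → (geo9Y x).M * α₀ ≤ aG →
      ∀ U : (bg9YR (Matrix (Fin N) (Fin N) ℂ) (specialUnitaryUnits (Fin N)) R₁ R₂ x).Cfg,
        (bg9YR (Matrix (Fin N) (Fin N) ℂ) (specialUnitaryUnits (Fin N)) R₁ R₂ x).Reg335 c α₀ U →
        (bg9YR (Matrix (Fin N) (Fin N) ℂ) (specialUnitaryUnits (Fin N)) R₁ R₂ x).Reg336 c α₀ U →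
          HasMaj (cNorm 1 (H x) (𝔬12 x).blkZ (fun y => (geo9Y_len_pos x y).le) 2)
            (weightNorm (BlockNorm.ofBlocks (toB6 (geo9Y x) 1 (H x)) (𝔬12 x).blkZ) (fun y => ((((θ.ℓ₆ + 1 : ℕ) : ℝ) ^ (θ.d₆ + 1)) ^ lvl x.hN x.D x.hk y)⁻¹)
              (fun y => (plateau_pos x.toKIdx y).le))
            ((𝔬12 x).C U) (fun a b => Bz * Real.exp (-(δC * (geo9Y x).dist a b))))
    -- [5] (149) for the form letter, at print's weight `(Lʲη)_c · n_c⁻¹`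
    (hC2 : ∀ x : MemberY θ.d₆ θ.ℓ₆ θ.hd' θ.hL' θ.b₀ θ.b₁ Mstar, MG ≤ (geo9Y x).M → ∀ α₀ : ℝ, 0 < α₀ → (geo9Y x).M * α₀ ≤ aG →
      ∀ U : (bg9YR (Matrix (Fin N) (Fin N) ℂ) (specialUnitaryUnits (Fin N)) R₁ R₂ x).Cfg,
        (bg9YR (Matrix (Fin N) (Fin N) ℂ) (specialUnitaryUnits (Fin N)) R₁ R₂ x).Reg335 c α₀ U →
        (bg9YR (Matrix (Fin N) (Fin N) ℂ) (specialUnitaryUnits (Fin N)) R₁ R₂ x).Reg336 c α₀ U →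
          C2FormMaj x.toKIdx (g := geo9Y x) (bI x) (fun c => c) (𝔠 x).form U κC δC2
            (fun c => (geo9Y x).len c * (((((θ.ℓ₆ + 1 : ℕ) : ℝ) ^ (θ.d₆ + 1)) ^ lvl x.hN x.D x.hk c)⁻¹))) :
    ∃ MD aD θ₂ : ℝ, 0 < aD ∧ aD ≤ aG ∧ 0 ≤ θ₂ ∧
      ∀ x : MemberY θ.d₆ θ.ℓ₆ θ.hd' θ.hL' θ.b₀ θ.b₁ Mstar, MD ≤ (geo9Y x).M → ∀ α₀ : ℝ, 0 < α₀ → (geo9Y x).M * α₀ ≤ aD →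
        ∀ U : (bg9YR (Matrix (Fin N) (Fin N) ℂ) (specialUnitaryUnits (Fin N)) R₁ R₂ x).Cfg,
          (bg9YR (Matrix (Fin N) (Fin N) ℂ) (specialUnitaryUnits (Fin N)) R₁ R₂ x).Reg335 c α₀ U →
          (bg9YR (Matrix (Fin N) (Fin N) ℂ) (specialUnitaryUnits (Fin N)) R₁ R₂ x).Reg336 c α₀ U →
            HasMajorant (g := toB6 (geo9Y x) 1 (H x)) (𝔬12 x).blk
              (D2coK x.toKIdx (trBasis N) (bg9YR (Matrix (Fin N) (Fin N) ℂ) (specialUnitaryUnits (Fin N)) R₁ R₂ x) (fun U => U)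
                (delta2OfY (trDualMatY N) x.toKIdx (parSymY x.toKIdx) (parBY x.toKIdx) (GpPhysY x.toKIdx (parSymY x.toKIdx)) (𝔠 x).form) U)
              (fun (a b : (geo9Y x).Site) => θ₂ * ((geo9Y x).M * α₀) * ((geo9Y x).len a ^ 2)⁻¹ * Real.exp (-(δ₂ * (geo9Y x).dist a b))) := by
  have hN : 0 < N := Nat.pos_of_ne_zero (NeZero.ne N)
  have hL0 : (0 : ℝ) ≤ ((θ.ℓ₆ + 1 : ℕ) : ℝ) := Nat.cast_nonneg _
  -- THE RATES OF THE ROAD, chosen here from the produced ones: target ρT below ρG, δC∕4 and the locality margin δC2 − δ₂; row sum σT = δC∕4; transfers τT = δC∕8; ρR = ρT∕2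
  set ρT : ℝ := min (min ρG (δC / 4)) (δC2 - δ₂) with hρTdef
  have hρT0 : 0 < ρT := lt_min (lt_min hρG (by linarith)) (by linarith)
  have hρT : 0 ≤ ρT := hρT0.le
  have hρTG : ρT ≤ ρG := (min_le_left _ _).trans (min_le_left _ _)
  have hρTC4 : ρT ≤ δC / 4 := (min_le_left _ _).trans (min_le_right _ _)
  have hρT2 : ρT ≤ δC2 - δ₂ := min_le_right _ _
  set σT : ℝ := δC / 4 with hσTdef
  have hσT : 0 < σT := by positivity
  set τT : ℝ := δC / 8 with hτTdef
  have hτT : 0 < τT := by positivity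
  set ρR : ℝ := ρT / 2 with hρRdef
  have hρR : 0 < ρR := by positivity
  -- an auxiliary side of primitive constants carrying the final transfer∕row-sum rates of n08-d's `(H*J)` lemma (only `α, αF, δ₀` matter): `αF(1−2α)δ₀ = ρT∕8`
  set qD : PinPrims := ⟨1 / 4, 0, 0, 0, 0, 1, 0, 0, 1, ρT, 1, 1, 1 / 4, 0, 0, 0, 0, 0, 0, 0, fun _ => 0, fun _ => 0, fun _ => 0, fun _ => 0, fun _ _ => 0⟩ with hqD
  have hq : qD.OK :=
    { α_pos := by norm_num [hqD], α_lt := by norm_num [hqD], Nc_nn := le_rfl, N'_nn := le_rfl, NF_nn := le_rfl, one_le_Cℓ := le_rfl, Kc_nn := le_rfl, θ₀_nn := le_rfl,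
      B₀_pos := one_pos, δ₀_pos := hρT0, a₁_pos := one_pos, M₁_pos := one_pos, αF_pos := by norm_num [hqD], αF_lt := by norm_num [hqD], NH_nn := le_rfl, NL_nn := le_rfl,
      BL_nn := le_rfl, NI_nn := le_rfl, N2_nn := le_rfl, B2_nn := le_rfl, θ2_nn := le_rfl, Bl_nn := fun _ _ _ => le_rfl, Bt_nn := fun _ _ _ => le_rfl,
      BI_nn := fun _ _ _ => le_rfl, BI2_nn := fun _ _ _ _ _ _ => le_rfl, θI_nn := fun _ _ => le_rfl }
  have hrate : qD.αF * ((1 - 2 * qD.α) * qD.δ₀) = ρT / 8 := by simp only [hqD]; ring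
  have hδC2' : δ₂ + qD.αF * ((1 - 2 * qD.α) * qD.δ₀) + ρR ≤ δC2 := by rw [hrate, hρRdef]; linarith
  have hρ' : qD.αF * ((1 - 2 * qD.α) * qD.δ₀) + ρR ≤ ρT := by rw [hrate, hρRdef]; linarith
  have hρTC : ρT + σT + τT ≤ δC - 1 / 2 * (2 * τT) := by rw [hσTdef, hτTdef]; linarith
  -- member facts for the len⁻² transfer inside F11 (rate τT at α := ½)
  obtain ⟨Mg, hFa⟩ := facts347_exp261_geo9Y (d := θ.d₆) (ℓ := θ.ℓ₆) (hd := θ.hd') (hL := θ.hL') (b₀ := θ.b₀) (b₁ := θ.b₁) (Mstar := Mstar) H (α := 1 / 2) (δ := 2 * τT)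
    (by norm_num) (by norm_num) (by linarith)
  -- the named constants of the road
  set cJ : ℝ := 10 * ((θ.ℓ₆ + 1 : ℕ) : ℝ) ^ 7 with hcJ
  have hcJ0 : 0 < cJ := by positivity
  set rC : ℝ := Bz * (((θ.ℓ₆ + 1 : ℕ) : ℝ)) ^ 2 with hrC
  have hrC0 : 0 ≤ rC := by positivity
  set tHJ : ℝ := N * basisBound39 (trBasis N) ^ 2 * (10 ^ 4 * ((θ.d₆ : ℝ) + 1) * cJ) *
      (((θ.d₆ : ℝ) + 1) * Fintype.card (TrIdx N) *
        (rC * (Real.exp ((ρG + σT + 1 / 2 * (2 * τT)) * ((θ.ℓ₆ : ℝ) + 4)) * rG * (((θ.ℓ₆ + 1 : ℕ) : ℝ)) ^ 2 *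
          rowConst261 (geo9Y (d := θ.d₆) (ℓ := θ.ℓ₆) (hd := θ.hd') (hL := θ.hL') (b₀ := θ.b₀) (b₁ := θ.b₁) (Mstar := Mstar)) σT) * (((θ.ℓ₆ + 1 : ℕ) : ℝ)) ^ 2 *
          rowConst261 (geo9Y (d := θ.d₆) (ℓ := θ.ℓ₆) (hd := θ.hd') (hL := θ.hL') (b₀ := θ.b₀) (b₁ := θ.b₁) (Mstar := Mstar)) σT)) *
      ((((θ.ℓ₆ + 1 : ℕ) : ℝ) ^ 3) * rowConst261 (geo9Y (d := θ.d₆) (ℓ := θ.ℓ₆) (hd := θ.hd') (hL := θ.hL') (b₀ := θ.b₀) (b₁ := θ.b₁) (Mstar := Mstar)) ρR) with htHJ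
  set θ₂ : ℝ := (B9Thm39ReadingCoords.cR39 (trBasis N))⁻¹ * (2 * N * basisBound39 (trBasis N) ^ 2 * κC * tHJ * (((θ.ℓ₆ + 1 : ℕ) : ℝ) ^ 2) *
      rowConst261 (geo9Y (d := θ.d₆) (ℓ := θ.ℓ₆) (hd := θ.hd') (hL := θ.hL') (b₀ := θ.b₀) (b₁ := θ.b₁) (Mstar := Mstar)) ρR) with hθ₂
  have hc261σ := rowConst261_nonneg (geo9Y (d := θ.d₆) (ℓ := θ.ℓ₆) (hd := θ.hd') (hL := θ.hL') (b₀ := θ.b₀) (b₁ := θ.b₁) (Mstar := Mstar)) σT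
  have hc261ρ := rowConst261_nonneg (geo9Y (d := θ.d₆) (ℓ := θ.ℓ₆) (hd := θ.hd') (hL := θ.hL') (b₀ := θ.b₀) (b₁ := θ.b₁) (Mstar := Mstar)) ρR
  have htHJ0 : 0 ≤ tHJ := by positivity
  have hθ₂0 : 0 ≤ θ₂ := by
    have hc : 0 < B9Thm39ReadingCoords.cR39 (trBasis N) := cR39_trBasis_pos hN
    positivity
  -- the produced regime: inside `aG` and print's «O(1)Mα₀ ≤ 1» for the cube-covering letter (`cJ·a ≤ 1`)
  set aD : ℝ := min aG (1 / cJ) with haD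
  have haD0 : 0 < aD := lt_min haG (by positivity)
  have haDG : aD ≤ aG := min_le_left _ _
  have ha1 : cJ * aD ≤ 1 := by
    have h1 : cJ * aD ≤ cJ * (1 / cJ) := mul_le_mul_of_nonneg_left (min_le_right _ _) hcJ0.le
    rwa [mul_one_div_cancel hcJ0.ne'] at h1
  -- the three inputs of the scaled road in its currencies
  have hMpos : 0 < max MG 1 := lt_max_of_lt_right one_pos
  have hGDsup : ∀ x : MemberY θ.d₆ θ.ℓ₆ θ.hd' θ.hL' θ.b₀ θ.b₁ Mstar, max (max MG 1) Mg ≤ (geo9Y x).M → ∀ α₀ : ℝ, 0 < α₀ → (geo9Y x).M * α₀ ≤ aD →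
      ∀ U : (bg9YR (Matrix (Fin N) (Fin N) ℂ) (specialUnitaryUnits (Fin N)) R₁ R₂ x).Cfg,
        (bg9YR (Matrix (Fin N) (Fin N) ℂ) (specialUnitaryUnits (Fin N)) R₁ R₂ x).Reg335 c α₀ U →
        (bg9YR (Matrix (Fin N) (Fin N) ℂ) (specialUnitaryUnits (Fin N)) R₁ R₂ x).Reg336 c α₀ U →
          HasMajorant (g := toB6 (geo9Y x) 1 (H x)) (blkBK x.toKIdx (bI x))
            (GcoK x.toKIdx (trBasis N) (bg9YR (Matrix (Fin N) (Fin N) ℂ) (specialUnitaryUnits (Fin N)) R₁ R₂ x) (fun U => U)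
              (GDY x.toKIdx (parSymY x.toKIdx) (parBY x.toKIdx) (GpPhysY x.toKIdx (parSymY x.toKIdx))) U)
            (fun a b => rG * (geo9Y x).len a ^ 2 * Real.exp (-(ρG * (geo9Y x).dist a b))) := by
    intro x hM α₀ hα ha U hU hU'
    have h := hGD x ((le_max_left _ _).trans ((le_max_left _ _).trans hM)) α₀ hα (ha.trans haDG) U hU hU'
    rw [hblk12 x, hGco12 x U] at h
    exact h
  have hCsup : ∀ x : MemberY θ.d₆ θ.ℓ₆ θ.hd' θ.hL' θ.b₀ θ.b₁ Mstar, max (max MG 1) Mg ≤ (geo9Y x).M → ∀ α₀ : ℝ, 0 < α₀ → (geo9Y x).M * α₀ ≤ aD →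
      ∀ U : (bg9YR (Matrix (Fin N) (Fin N) ℂ) (specialUnitaryUnits (Fin N)) R₁ R₂ x).Cfg,
        (bg9YR (Matrix (Fin N) (Fin N) ℂ) (specialUnitaryUnits (Fin N)) R₁ R₂ x).Reg335 c α₀ U →
        (bg9YR (Matrix (Fin N) (Fin N) ℂ) (specialUnitaryUnits (Fin N)) R₁ R₂ x).Reg336 c α₀ U →
          HasMajorant (g := toB6 (geo9Y x) 1 (H x)) (blkHK x.toKIdx)
            (CcoK x.toKIdx (trBasis N) (bg9YR (Matrix (Fin N) (Fin N) ℂ) (specialUnitaryUnits (Fin N)) R₁ R₂ x) (fun U => U)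
              (parSymY x.toKIdx) (parBY x.toKIdx) (GpPhysY x.toKIdx (parSymY x.toKIdx)) U)
            (fun a b => rC * ((((((θ.ℓ₆ + 1 : ℕ) : ℝ) ^ (θ.d₆ + 1)) ^ lvl x.hN x.D x.hk a)⁻¹)⁻¹ * ((geo9Y x).len a ^ 2)⁻¹) *
              Real.exp (-((δC - 1 / 2 * (2 * τT)) * (geo9Y x).dist a b))) := by
    intro x hM α₀ hα ha U hU hU'
    have hG : GeoOK (geo9Y x) := ⟨geo9Y_dist_triangle x, geo9Y_dist_comm x, geo9K_dist_nonneg x.toKIdx, geo9Y_len_pos x⟩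
    have h := hc2 x ((le_max_left _ _).trans ((le_max_left _ _).trans hM)) α₀ hα (ha.trans haDG) U hU hU'
    rw [hblkZ12 x, hCco12 x U] at h
    have h' := hasMajorantHom_of_hasMaj_cNorm_weightNorm (R₀ := 1) (H₀ := H x) hG (hFa x ((le_max_right _ _).trans hM)) hBz
      (W := fun y => ((((θ.ℓ₆ + 1 : ℕ) : ℝ) ^ (θ.d₆ + 1)) ^ lvl x.hN x.D x.hk y)⁻¹) (plateau_pos x.toKIdx) h
    refine hasMajorant_mono _ ((hasMajorantHom_iff _ _ _).1 h') fun a b => le_of_eq ?_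
    rw [hrC]
  have hreg : ∀ x : MemberY θ.d₆ θ.ℓ₆ θ.hd' θ.hL' θ.b₀ θ.b₁ Mstar, max (max MG 1) Mg ≤ (geo9Y x).M → ∀ α₀ : ℝ, 0 < α₀ → (geo9Y x).M * α₀ ≤ aD →
      ∀ U : (bg9YR (Matrix (Fin N) (Fin N) ℂ) (specialUnitaryUnits (Fin N)) R₁ R₂ x).Cfg,
        (bg9YR (Matrix (Fin N) (Fin N) ℂ) (specialUnitaryUnits (Fin N)) R₁ R₂ x).Reg335 c α₀ U →
        (bg9YR (Matrix (Fin N) (Fin N) ℂ) (specialUnitaryUnits (Fin N)) R₁ R₂ x).Reg336 c α₀ U →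
          ∀ μ s, B9Eq336CurrentBound.RegularAt (B9BackgroundsKLevelV1.shiftsV1 (B6GlobalChartV1.PV θ.d₆ θ.ℓ₆ x.toKIdx.m x.toKIdx.K θ.hd' θ.hL')) U (etaBY x.toKIdx)
            (cJ * ((geo9Y x).M * α₀)) ((geo9Y x).len (bI x ⟨s, 0⟩)) μ s :=
    fun x _ α₀ hα _ U _ hU' μ s => regularAt_pinScale_of_regYP336 x c35Y_le_ten hα.le (hRP2 x α₀ U hU').2 (bI x) (hβ1 x) μ ⟨s, 0⟩
  -- the scaled road
  obtain ⟨ML, hsup⟩ := hD2sup_of_GD_C_lettersRP_sq qD hq H 𝔠 R₁ R₂ hGR c 𝔬12 bI hbI0 hβ1 hblk12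
    (fun x c => (geo9Y x).len c * (((((θ.ℓ₆ + 1 : ℕ) : ℝ) ^ (θ.d₆ + 1)) ^ lvl x.hN x.D x.hk c)⁻¹))
    (fun x a => ((((((θ.ℓ₆ + 1 : ℕ) : ℝ) ^ (θ.d₆ + 1)) ^ lvl x.hN x.D x.hk a)⁻¹)⁻¹ * ((geo9Y x).len a ^ 2)⁻¹))
    (fun x c => mul_nonneg (geo9Y_len_pos x c).le (plateau_pos x.toKIdx c).le)
    (fun x a => mul_nonneg (inv_nonneg.mpr (plateau_pos x.toKIdx a).le) (inv_nonneg.mpr (pow_nonneg (geo9Y_len_pos x a).le 2)))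
    (fun x c => le_of_eq (weights_mul_eq (geo9Y_len_pos x c) (inv_pos.mp (plateau_pos x.toKIdx c))))
    κC δC2 rG ρG rC (δC - 1 / 2 * (2 * τT)) σT τT ρT cJ ρR tHJ δ₂ θ₂ (max (max MG 1) Mg) aD hκC hrG hrC0 hσT hτT hρT hρTG hρTC hcJ0.le hρR hδ₂
    (lt_max_of_lt_left hMpos) ha1 hδC2' hρ' (le_of_eq htHJ.symm) (le_of_eq hθ₂.symm)
    (fun x hM α₀ hα ha U hU hU' => hC2 x ((le_max_left _ _).trans ((le_max_left _ _).trans hM)) α₀ hα (ha.trans haDG) U hU hU')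
    hGDsup hCsup hreg
  exact ⟨max ML (max (max MG 1) Mg), aD, θ₂, haD0, haDG, hθ₂0, fun x hM α₀ hα ha U hU hU' =>
    hsup x ((le_max_left _ _).trans hM) ((le_max_right _ _).trans hM) α₀ hα ha U hU hU'⟩

end Summit.QuantumFields.YangMills.BalabanUVNodes.N06D2SupLegAtPinsPUW

end
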